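import Literature.AnabelianGeometry.SemiGraphs.HomRestrictNested

/-!
# Extension by terminal objects `B(𝒢|_K) → B(𝒢|_{K̄})` across a clopen sub-semi-graph, and `Π_K ↠ Π_{K̄}`

Mochizuki, *Semi-graphs of anabelioids*, Publ. RIMS **42** (2006), Def. 2.1 p. 24 (`𝒢_ℍ`, `Π_ℍ`)
and §2 p. 30, proof of Corollary 2.7 (i): for the restriction `ℋ′ → ℍ` of a finite étale covering
and "a connected component `ℋ″` of `ℋ′`", print passes silently between `ℋ″` and `ℋ′` ("`ℋ′`
injects into `𝒢′`"; the subgroup `Π_{ℋ″} ⊆ Π_{𝒢′}`).  The formal content of that passage is: for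
`K ⊆ K̄` with `K` a union of connected components of `K̄` — along every branch `b : e → v` of `K̄`,
`e ∈ K ↔ v ∈ K` (`hcl` below) — every automorphism of the basepoint of `B(𝒢|_{K̄})` through a vertex
`w ∈ K` comes from an automorphism of the basepoint of `B(𝒢|_K)` through `w`, i.e.
`π₁(restrictFunctor₂) : Π_K → Π_{K̄}` is ONTO (`pi1Map_restrictFunctor₂_surjective`).
[cite: MochizukiSemiAnbd2006, Cor. 2.7(i) p.30]

Construction (abc-iut cell, layer L3, D3b cut α7-1/α12-4, piece (COMP); route (iv) of
abc-iut-w4-d071): the EXTENSION BY TERMINAL OBJECTS `Y ↦ Ỹ` of an object of `B(𝒢|_K)` to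
`B(𝒢|_{K̄})`, written WITHOUT case distinction as the product `Ỹ_v := ∏_{h : v ∈ K} Y_v` over the
(empty or one-point) type of proofs of `v ∈ K` (so `Ỹ_v = Y_v` on `K` and `Ỹ_v = ⊤` off `K`), glued
along a branch `b : e → v` of `K̄` through `b^*(∏ Y_v) ≅ ∏ b^* Y_v ≅ ∏ Y_e` (exactness of `b^*`, the
gluing of `Y`, and `e ∈ K ↔ v ∈ K`); its action on morphisms (`extMap`), the unit
`X → (X|_K)~` (`extUnit`) and the identification `Ỹ_w ≅ Y_w` at `w ∈ K` (`extCounitIso`).  Then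
`σ ↦ τ`, `τ_Y := σ_{Ỹ}` read through `Ỹ_w ≅ Y_w`, inverts `π₁(restrictFunctor₂)` on the right
(naturality of `σ` along `extMap` and along the unit).  Only the object and morphism maps are needed
(no functor laws are asserted).  All objects over `K̄` are typed through the constituents of `𝒢|_{K̄}`.
Nothing here takes a side on [IUTchIII] Cor. 3.12.
-/

namespace Literature.AnabelianGeometry.SemiGraphs

open CategoryTheory CategoryTheory.Limits CategoryTheory.Functor
open Literature.AnabelianGeometry.Anabelioids

universe w v₁ u₁ u

/-- In a sub-semi-graph, a branch abutting a vertex in the ambient semi-graph abuts it in the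
sub-semi-graph as soon as both are members (condition (b) of [SemiAnbd] §1 p. 12).
[cite: MochizukiSemiAnbd2006, §1 p.12] -/
theorem SemiGraph.Subgraph.abuts_mk {G : SemiGraph.{u}} (K : G.Subgraph) (b : G.Branch)
    (v : G.Vertex) (h : G.abuts b = some v) (hb : G.edgeOf b ∈ K.edges) (hv : v ∈ K.verts) :
    K.toSemiGraph.abuts ⟨b, hb⟩ = some ⟨v, hv⟩ := by
  change (G.abuts b).pbind _ = _
  simp only [h, Option.pbind_some]
  exact dif_pos hv

namespace SemiGraphOfAnabelioids

variable (𝒢 : SemiGraphOfAnabelioids.{v₁, u₁, u}) {K' K : 𝒢.graph.Subgraph}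
  (hV : K.verts ⊆ K'.verts) (hE : K.edges ⊆ K'.edges)

namespace TerminalExtension

/-! ### The extension by terminal objects, on objects -/

/-- The family `(Y_v)_{h : v ∈ K}` indexed by the proofs of `v ∈ K` (empty off `K`, a singleton
on `K`), as objects of the constituent `(𝒢|_{K̄})_v = 𝒢_v`. [cite: MochizukiSemiAnbd2006, Def. 2.1 p.24] -/
abbrev famS (Y : (𝒢.restrict K).BObj) (v : (𝒢.restrict K').graph.Vertex) :
    PLift (v.1 ∈ K.verts) → (𝒢.restrict K').V v :=
  fun h => Y.S ⟨v.1, h.down⟩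

/-- The family `(Y_e)_{h : e ∈ K}` indexed by the proofs of `e ∈ K`.
[cite: MochizukiSemiAnbd2006, Def. 2.1 p.24] -/
abbrev famT (Y : (𝒢.restrict K).BObj) (e : (𝒢.restrict K').graph.Edge) :
    PLift (e.1 ∈ K.edges) → (𝒢.restrict K').E e :=
  fun h => Y.T ⟨e.1, h.down⟩

/-- The family `(b^* Y_v)_{h : v ∈ K}` along a branch `b : e → v` of `K̄`.
[cite: MochizukiSemiAnbd2006, Def. 2.1 p.23] -/
noncomputable abbrev famPull (Y : (𝒢.restrict K).BObj) (b : (𝒢.restrict K').graph.Branch)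
    (v : (𝒢.restrict K').graph.Vertex) (h : (𝒢.restrict K').graph.abuts b = some v) :
    PLift (v.1 ∈ K.verts) → (𝒢.restrict K').E ((𝒢.restrict K').graph.edgeOf b) :=
  fun hv => ((𝒢.restrict K').pull b v h).pullback.obj (famS 𝒢 Y v hv)

/-- Vertex objects of the extension: `Ỹ_v := ∏_{h : v ∈ K} Y_v` (`= Y_v` for `v ∈ K`, terminal for
`v ∉ K`). [cite: MochizukiSemiAnbd2006, Def. 2.1 p.24] -/
noncomputable abbrev extS (Y : (𝒢.restrict K).BObj) (v : (𝒢.restrict K').graph.Vertex) :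
    (𝒢.restrict K').V v :=
  ∏ᶜ famS 𝒢 Y v

/-- Edge objects of the extension: `Ỹ_e := ∏_{h : e ∈ K} Y_e`.
[cite: MochizukiSemiAnbd2006, Def. 2.1 p.24] -/
noncomputable abbrev extT (Y : (𝒢.restrict K).BObj) (e : (𝒢.restrict K').graph.Edge) :
    (𝒢.restrict K').E e :=
  ∏ᶜ famT 𝒢 Y e

/-- The finite products `∏_{h : v ∈ K} Y_v` exist (Galois categories have finite products; the
index type is finite). [cite: MochizukiSemiAnbd2006, Def. 2.1 p.24] -/
theorem hasProduct_famS (Y : (𝒢.restrict K).BObj) (v : (𝒢.restrict K').graph.Vertex) :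
    HasProduct (famS 𝒢 Y v) := inferInstance

/-- The finite products `∏_{h : e ∈ K} Y_e` exist. [cite: MochizukiSemiAnbd2006, Def. 2.1 p.24] -/
theorem hasProduct_famT (Y : (𝒢.restrict K).BObj) (e : (𝒢.restrict K').graph.Edge) :
    HasProduct (famT 𝒢 Y e) := inferInstance

/-- The finite products `∏_{h : v ∈ K} b^* Y_v` exist. [cite: MochizukiSemiAnbd2006, Def. 2.1 p.24] -/
theorem hasProduct_famPull (Y : (𝒢.restrict K).BObj) (b : (𝒢.restrict K').graph.Branch)
    (v : (𝒢.restrict K').graph.Vertex) (h : (𝒢.restrict K').graph.abuts b = some v) :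
    HasProduct (famPull 𝒢 Y b v h) := inferInstance

/-- `b^*` preserves the finite product `∏_{h : v ∈ K} Y_v` (it is exact).
[cite: MochizukiSemiAnbd2006, Def. 2.1 p.22] -/
theorem preservesLimit_famS (Y : (𝒢.restrict K).BObj) (b : (𝒢.restrict K').graph.Branch)
    (v : (𝒢.restrict K').graph.Vertex) (h : (𝒢.restrict K').graph.abuts b = some v) :
    PreservesLimit (Discrete.functor (famS 𝒢 Y v)) ((𝒢.restrict K').pull b v h).pullback := by
  haveI : PreservesFiniteLimits ((𝒢.restrict K').pull b v h).pullback :=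
    ((𝒢.restrict K').pull b v h).property.1
  infer_instance

variable (hcl : ∀ (b : 𝒢.graph.Branch) (v : 𝒢.graph.Vertex), 𝒢.graph.edgeOf b ∈ K'.edges →
    v ∈ K'.verts → 𝒢.graph.abuts b = some v → (𝒢.graph.edgeOf b ∈ K.edges ↔ v ∈ K.verts))

/-- Along a branch `b : e → v` of `K̄`, `v ∈ K` gives `e ∈ K` (clopenness).
[cite: MochizukiSemiAnbd2006, Cor. 2.7(i) p.30] -/
abbrev toE (b : (𝒢.restrict K').graph.Branch) (v : (𝒢.restrict K').graph.Vertex)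
    (h : (𝒢.restrict K').graph.abuts b = some v) (hv : PLift (v.1 ∈ K.verts)) :
    PLift (((𝒢.restrict K').graph.edgeOf b).1 ∈ K.edges) :=
  ⟨(hcl b.1 v.1 b.2 v.2 (K'.ι.abuts_branchMap b v h)).mpr hv.down⟩

/-- Along a branch `b : e → v` of `K̄`, `e ∈ K` gives `v ∈ K` (clopenness).
[cite: MochizukiSemiAnbd2006, Cor. 2.7(i) p.30] -/
abbrev toV (b : (𝒢.restrict K').graph.Branch) (v : (𝒢.restrict K').graph.Vertex)
    (h : (𝒢.restrict K').graph.abuts b = some v)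
    (he : PLift (((𝒢.restrict K').graph.edgeOf b).1 ∈ K.edges)) : PLift (v.1 ∈ K.verts) :=
  ⟨(hcl b.1 v.1 b.2 v.2 (K'.ι.abuts_branchMap b v h)).mp he.down⟩

/-- The gluing of `Y` along a branch `b : e → v` of `K̄` with `e ∈ K` (hence `v ∈ K`), read on the
constituents of `𝒢|_{K̄}`: `b^* Y_v ≅ Y_e`. [cite: MochizukiSemiAnbd2006, Def. 2.1 p.23] -/
noncomputable def gluingK (Y : (𝒢.restrict K).BObj) (b : (𝒢.restrict K').graph.Branch)
    (v : (𝒢.restrict K').graph.Vertex) (h : (𝒢.restrict K').graph.abuts b = some v)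
    (he : PLift (((𝒢.restrict K').graph.edgeOf b).1 ∈ K.edges)) :
    famPull 𝒢 Y b v h (toV 𝒢 hcl b v h he) ≅ famT 𝒢 Y ((𝒢.restrict K').graph.edgeOf b) he :=
  Y.ψ ⟨b.1, he.down⟩ ⟨v.1, (toV 𝒢 hcl b v h he).down⟩
    (K.abuts_mk b.1 v.1 (K'.ι.abuts_branchMap b v h) he.down (toV 𝒢 hcl b v h he).down)

/-- The core of the gluing of the extension along a branch `b : e → v` of `K̄`:
`∏_{v ∈ K} b^* Y_v ≅ ∏_{e ∈ K} Y_e` — the gluing of `Y` re-indexed along `e ∈ K ↔ v ∈ K`.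
[cite: MochizukiSemiAnbd2006, Def. 2.1 p.23] -/
noncomputable def extψCore (Y : (𝒢.restrict K).BObj) (b : (𝒢.restrict K').graph.Branch)
    (v : (𝒢.restrict K').graph.Vertex) (h : (𝒢.restrict K').graph.abuts b = some v) :
    (∏ᶜ famPull 𝒢 Y b v h) ≅ extT 𝒢 Y ((𝒢.restrict K').graph.edgeOf b) :=
  haveI := hasProduct_famPull 𝒢 Y b v h
  haveI := hasProduct_famT 𝒢 Y ((𝒢.restrict K').graph.edgeOf b)
  { hom := Limits.Pi.lift fun he : PLift (((𝒢.restrict K').graph.edgeOf b).1 ∈ K.edges) =>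
      Limits.Pi.π (famPull 𝒢 Y b v h) (toV 𝒢 hcl b v h he) ≫ (gluingK 𝒢 hcl Y b v h he).hom
    inv := Limits.Pi.lift fun hv : PLift (v.1 ∈ K.verts) =>
      Limits.Pi.π (famT 𝒢 Y ((𝒢.restrict K').graph.edgeOf b)) (toE 𝒢 hcl b v h hv) ≫
        (gluingK 𝒢 hcl Y b v h (toE 𝒢 hcl b v h hv)).inv
    hom_inv_id := by
      refine Limits.Pi.hom_ext _ _ fun hv => ?_
      simp only [Category.assoc, Limits.Pi.lift_π, Limits.Pi.lift_π_assoc, Category.id_comp,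
        Iso.hom_inv_id, Category.comp_id]
    inv_hom_id := by
      refine Limits.Pi.hom_ext _ _ fun he => ?_
      simp only [Category.assoc, Limits.Pi.lift_π, Limits.Pi.lift_π_assoc, Category.id_comp,
        Iso.inv_hom_id, Category.comp_id] }

/-- The gluing of the extension along a branch `b : e → v` of `K̄`:
`b^*(∏_{v ∈ K} Y_v) ≅ ∏_{v ∈ K} b^* Y_v ≅ ∏_{e ∈ K} Y_e` (exactness of `b^*`, then `extψCore`).
[cite: MochizukiSemiAnbd2006, Def. 2.1 p.23] -/
noncomputable def extψ (Y : (𝒢.restrict K).BObj) (b : (𝒢.restrict K').graph.Branch)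
    (v : (𝒢.restrict K').graph.Vertex) (h : (𝒢.restrict K').graph.abuts b = some v) :
    ((𝒢.restrict K').pull b v h).pullback.obj (extS 𝒢 Y v) ≅
      extT 𝒢 Y ((𝒢.restrict K').graph.edgeOf b) :=
  haveI := hasProduct_famS 𝒢 Y v
  haveI := hasProduct_famPull 𝒢 Y b v h
  haveI := preservesLimit_famS 𝒢 Y b v h
  PreservesProduct.iso ((𝒢.restrict K').pull b v h).pullback (famS 𝒢 Y v) ≪≫ extψCore 𝒢 hcl Y b v h

/-- **Extension by terminal objects** `Y ↦ Ỹ ∈ B(𝒢|_{K̄})` of an object `Y ∈ B(𝒢|_K)`, for `K` clopen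
in `K̄`. [cite: MochizukiSemiAnbd2006, Def. 2.1 p.24] -/
noncomputable abbrev extObj (Y : (𝒢.restrict K).BObj) : (𝒢.restrict K').BObj where
  S := extS 𝒢 Y
  T := extT 𝒢 Y
  ψ := extψ 𝒢 hcl Y

/-- The components of the gluing of `Ỹ`: projecting `b^* Ỹ_v → Ỹ_e → Y_e` at a proof of `e ∈ K` is
`b^*(pr) ≫ ψ^Y_b`. [cite: MochizukiSemiAnbd2006, Def. 2.1 p.23] -/
@[reassoc]
theorem extψ_hom_π (Y : (𝒢.restrict K).BObj) (b : (𝒢.restrict K').graph.Branch)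
    (v : (𝒢.restrict K').graph.Vertex) (h : (𝒢.restrict K').graph.abuts b = some v)
    (he : PLift (((𝒢.restrict K').graph.edgeOf b).1 ∈ K.edges)) :
    haveI := hasProduct_famS 𝒢 Y v
    haveI := hasProduct_famT 𝒢 Y ((𝒢.restrict K').graph.edgeOf b)
    (extψ 𝒢 hcl Y b v h).hom ≫ Limits.Pi.π (famT 𝒢 Y ((𝒢.restrict K').graph.edgeOf b)) he =
      ((𝒢.restrict K').pull b v h).pullback.map (Limits.Pi.π (famS 𝒢 Y v) (toV 𝒢 hcl b v h he)) ≫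
        (gluingK 𝒢 hcl Y b v h he).hom := by
  haveI := hasProduct_famS 𝒢 Y v
  haveI := hasProduct_famT 𝒢 Y ((𝒢.restrict K').graph.edgeOf b)
  haveI := hasProduct_famPull 𝒢 Y b v h
  haveI := preservesLimit_famS 𝒢 Y b v h
  simp only [extψ, extψCore, Iso.trans_hom, Category.assoc, Limits.Pi.lift_π,
    PreservesProduct.iso_hom, piComparison_comp_π_assoc]

/-! ### The extension on morphisms, the unit, and the counit at a vertex of `K` -/

/-- The extension of a morphism `f : Y → Y′` of `B(𝒢|_K)`: `∏ f_v` on vertices, `∏ f_e` on edges.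
[cite: MochizukiSemiAnbd2006, Def. 2.1 p.23] -/
noncomputable def extMap {Y Y' : (𝒢.restrict K).BObj} (f : Y ⟶ Y') :
    extObj 𝒢 hcl Y ⟶ extObj 𝒢 hcl Y' where
  fS v :=
    haveI := hasProduct_famS 𝒢 Y v
    haveI := hasProduct_famS 𝒢 Y' v
    Limits.Pi.map (f := famS 𝒢 Y v) (g := famS 𝒢 Y' v) fun hv => f.fS ⟨v.1, hv.down⟩
  fT e :=
    haveI := hasProduct_famT 𝒢 Y e
    haveI := hasProduct_famT 𝒢 Y' e
    Limits.Pi.map (f := famT 𝒢 Y e) (g := famT 𝒢 Y' e) fun he => f.fT ⟨e.1, he.down⟩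
  comm b v h := by
    haveI := hasProduct_famS 𝒢 Y v
    haveI := hasProduct_famS 𝒢 Y' v
    haveI := hasProduct_famT 𝒢 Y ((𝒢.restrict K').graph.edgeOf b)
    haveI := hasProduct_famT 𝒢 Y' ((𝒢.restrict K').graph.edgeOf b)
    refine Limits.Pi.hom_ext _ _ fun he => ?_
    change (_ ≫ (extψ 𝒢 hcl Y' b v h).hom) ≫ _ = ((extψ 𝒢 hcl Y b v h).hom ≫ _) ≫ _
    simp only [Category.assoc, Limits.Pi.map_π, extψ_hom_π, extψ_hom_π_assoc]
    simp only [← Functor.map_comp_assoc, Limits.Pi.map_π]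
    simp only [Functor.map_comp, Category.assoc]
    have hc := f.comm ⟨b.1, he.down⟩ ⟨v.1, (toV 𝒢 hcl b v h he).down⟩
      (K.abuts_mk b.1 v.1 (K'.ι.abuts_branchMap b v h) he.down (toV 𝒢 hcl b v h he).down)
    exact congrArg (fun t => ((𝒢.restrict K').pull b v h).pullback.map
      (Limits.Pi.π (famS 𝒢 Y v) (toV 𝒢 hcl b v h he)) ≫ t) hc

/-- The unit `X → (X|_K)~` for `X ∈ B(𝒢|_{K̄})`: the identity on `K`, the unique map to the terminal
object off `K` (both at once as the tuple of identities). [cite: MochizukiSemiAnbd2006, Def. 2.1 p.23] -/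
noncomputable def extUnit (X : (𝒢.restrict K').BObj) :
    X ⟶ extObj 𝒢 hcl ((𝒢.restrictFunctor₂ K' K hV hE).obj X) where
  fS v :=
    haveI := hasProduct_famS 𝒢 ((𝒢.restrictFunctor₂ K' K hV hE).obj X) v
    Limits.Pi.lift (f := famS 𝒢 ((𝒢.restrictFunctor₂ K' K hV hE).obj X) v)
      fun hv => (𝟙 (famS 𝒢 ((𝒢.restrictFunctor₂ K' K hV hE).obj X) v hv) : X.S v ⟶ _)
  fT e :=
    haveI := hasProduct_famT 𝒢 ((𝒢.restrictFunctor₂ K' K hV hE).obj X) e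
    Limits.Pi.lift (f := famT 𝒢 ((𝒢.restrictFunctor₂ K' K hV hE).obj X) e)
      fun he => (𝟙 (famT 𝒢 ((𝒢.restrictFunctor₂ K' K hV hE).obj X) e he) : X.T e ⟶ _)
  comm b v h := by
    haveI := hasProduct_famS 𝒢 ((𝒢.restrictFunctor₂ K' K hV hE).obj X) v
    haveI := hasProduct_famT 𝒢 ((𝒢.restrictFunctor₂ K' K hV hE).obj X)
      ((𝒢.restrict K').graph.edgeOf b)
    refine Limits.Pi.hom_ext _ _ fun he => ?_
    change (_ ≫ (extψ 𝒢 hcl _ b v h).hom) ≫ _ = _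
    simp only [Category.assoc, extψ_hom_π, Limits.Pi.lift_π]
    simp only [← Functor.map_comp_assoc, Limits.Pi.lift_π]
    erw [CategoryTheory.Functor.map_id, Category.id_comp, Category.comp_id]
    rfl

variable (w : 𝒢.graph.Vertex) (hw : w ∈ K.verts)

/-- At a vertex `w ∈ K` the extension does nothing: `Ỹ_w = ∏_{w ∈ K} Y_w ≅ Y_w` (projection at the
given proof of `w ∈ K`). [cite: MochizukiSemiAnbd2006, Def. 2.1 p.24] -/
noncomputable def extCounitIso (Y : (𝒢.restrict K).BObj) :
    extS 𝒢 Y ⟨w, hV hw⟩ ≅ famS 𝒢 Y ⟨w, hV hw⟩ ⟨hw⟩ :=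
  haveI := hasProduct_famS 𝒢 Y ⟨w, hV hw⟩
  { hom := Limits.Pi.π (famS 𝒢 Y ⟨w, hV hw⟩) ⟨hw⟩
    inv := Limits.Pi.lift (f := famS 𝒢 Y ⟨w, hV hw⟩) fun _ => 𝟙 (famS 𝒢 Y ⟨w, hV hw⟩ ⟨hw⟩)
    hom_inv_id := by
      refine Limits.Pi.hom_ext _ _ fun hw' => ?_
      simp only [Category.assoc, Limits.Pi.lift_π, Category.comp_id, Category.id_comp]
    inv_hom_id := by simp only [Limits.Pi.lift_π] }

/-- The extension of `f` at `w ∈ K` is `f_w`. [cite: MochizukiSemiAnbd2006, Def. 2.1 p.23] -/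
theorem extMap_fS_comp_extCounitIso_hom {Y Y' : (𝒢.restrict K).BObj} (f : Y ⟶ Y') :
    (extMap 𝒢 hcl f).fS ⟨w, hV hw⟩ ≫ (extCounitIso 𝒢 hV w hw Y').hom =
      (extCounitIso 𝒢 hV w hw Y).hom ≫ f.fS ⟨w, hw⟩ := by
  haveI := hasProduct_famS 𝒢 Y ⟨w, hV hw⟩
  haveI := hasProduct_famS 𝒢 Y' ⟨w, hV hw⟩
  simp only [extMap, extCounitIso, Limits.Pi.map_π]

/-- The unit at `w ∈ K` is the identity (triangle identity). [cite: MochizukiSemiAnbd2006, Def. 2.1 p.23] -/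
theorem extUnit_fS_comp_extCounitIso_hom (X : (𝒢.restrict K').BObj) :
    (extUnit 𝒢 hV hE hcl X).fS ⟨w, hV hw⟩ ≫
        (extCounitIso 𝒢 hV w hw ((𝒢.restrictFunctor₂ K' K hV hE).obj X)).hom = 𝟙 _ := by
  haveI := hasProduct_famS 𝒢 ((𝒢.restrictFunctor₂ K' K hV hE).obj X) ⟨w, hV hw⟩
  simp only [extUnit, extCounitIso, Limits.Pi.lift_π]

end TerminalExtension

/-! ### `Π_K → Π_{K̄}` is onto for `K` clopen in `K̄` -/

open TerminalExtension in
/-- **`Π_K ↠ Π_{K̄}` for `K` a union of connected components of `K̄`** ([SemiAnbd] p. 30, the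
passage `ℋ″ ⊆ ℋ′`): every automorphism `σ` of the basepoint `X ↦ F(X_w)` of `B(𝒢|_{K̄})` through
`w ∈ K` is the whiskering along `restrictFunctor₂ : B(𝒢|_{K̄}) → B(𝒢|_K)` of an automorphism `τ` of
the basepoint of `B(𝒢|_K)` through `w` — namely `τ_Y := σ_{Ỹ}` read through `Ỹ_w ≅ Y_w`; naturality
of `σ` along `extMap` makes `τ` natural, and along the unit `X → (X|_K)~` gives `τ_{X|_K} = σ_X`.
[cite: MochizukiSemiAnbd2006, Cor. 2.7(i) p.30] -/
theorem pi1Map_restrictFunctor₂_surjective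
    (hcl : ∀ (b : 𝒢.graph.Branch) (v : 𝒢.graph.Vertex), 𝒢.graph.edgeOf b ∈ K'.edges →
      v ∈ K'.verts → 𝒢.graph.abuts b = some v → (𝒢.graph.edgeOf b ∈ K.edges ↔ v ∈ K.verts))
    (w : 𝒢.graph.Vertex) (hw : w ∈ K.verts) (F : 𝒢.V w ⥤ FintypeCat.{w}) :
    Function.Surjective
      (pi1Map (𝒢.restrictFunctor₂ K' K hV hE) ((𝒢.restrict K).ρ ⟨w, hw⟩ ⋙ F)) := by
  intro σ
  -- naturality of `σ`, read pointwise on the fibres at `w`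
  have hσnat : ∀ {X X' : (𝒢.restrict K').BObj} (g : X ⟶ X') (y : F.obj (X.S ⟨w, hV hw⟩)),
      σ.hom.app X' (F.map (g.fS ⟨w, hV hw⟩) y) = F.map (g.fS ⟨w, hV hw⟩) (σ.hom.app X y) := by
    intro X X' g y
    have h := ConcreteCategory.congr_hom (σ.hom.naturality g) y
    rw [FintypeCat.comp_apply, FintypeCat.comp_apply] at h
    exact h
  -- the candidate preimage `τ`: `τ_Y := σ_{Ỹ}` read through `Ỹ_w ≅ Y_w`
  let τ : (𝒢.restrict K).ρ ⟨w, hw⟩ ⋙ F ≅ (𝒢.restrict K).ρ ⟨w, hw⟩ ⋙ F := NatIso.ofComponents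
    (fun Y => F.mapIso (extCounitIso 𝒢 hV w hw Y).symm ≪≫ σ.app (extObj 𝒢 hcl Y) ≪≫
      F.mapIso (extCounitIso 𝒢 hV w hw Y))
    (by
      intro Y Y' f
      have hK1 := extMap_fS_comp_extCounitIso_hom 𝒢 hV hcl w hw f
      have hK1' : (extCounitIso 𝒢 hV w hw Y).inv ≫ (extMap 𝒢 hcl f).fS ⟨w, hV hw⟩ =
          f.fS ⟨w, hw⟩ ≫ (extCounitIso 𝒢 hV w hw Y').inv :=
        (Iso.inv_comp_eq _).mpr (((Iso.eq_comp_inv _).mpr hK1).trans (Category.assoc _ _ _))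
      -- pointwise forms
      have q1 : ∀ y, F.map ((extMap 𝒢 hcl f).fS ⟨w, hV hw⟩)
            (F.map (extCounitIso 𝒢 hV w hw Y).inv y) =
          F.map (extCounitIso 𝒢 hV w hw Y').inv (F.map (f.fS ⟨w, hw⟩) y) := fun y => by
        have h := ConcreteCategory.congr_hom
          ((F.map_comp _ _).symm.trans ((congrArg F.map hK1').trans (F.map_comp _ _))) y
        simpa only [FintypeCat.comp_apply] using h
      have q4 : ∀ z, F.map (extCounitIso 𝒢 hV w hw Y').hom
            (F.map ((extMap 𝒢 hcl f).fS ⟨w, hV hw⟩) z) =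
          F.map (f.fS ⟨w, hw⟩) (F.map (extCounitIso 𝒢 hV w hw Y).hom z) := fun z => by
        have h := ConcreteCategory.congr_hom
          ((F.map_comp _ _).symm.trans ((congrArg F.map hK1).trans (F.map_comp _ _))) z
        simpa only [FintypeCat.comp_apply] using h
      have q2 := hσnat (extMap 𝒢 hcl f)
      refine FintypeCat.hom_ext _ _ fun x => ?_
      change F.map (extCounitIso 𝒢 hV w hw Y').hom (σ.hom.app (extObj 𝒢 hcl Y')
          (F.map (extCounitIso 𝒢 hV w hw Y').inv (F.map (f.fS ⟨w, hw⟩) x))) =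
        F.map (f.fS ⟨w, hw⟩) (F.map (extCounitIso 𝒢 hV w hw Y).hom
          (σ.hom.app (extObj 𝒢 hcl Y) (F.map (extCounitIso 𝒢 hV w hw Y).inv x)))
      rw [← q1, q2, q4])
  refine ⟨τ, ?_⟩
  apply Iso.ext
  refine NatTrans.ext (funext fun X => ?_)
  rw [pi1Map_hom_app]
  refine FintypeCat.hom_ext _ _ fun x => ?_
  change F.map (extCounitIso 𝒢 hV w hw ((𝒢.restrictFunctor₂ K' K hV hE).obj X)).hom
      (σ.hom.app (extObj 𝒢 hcl ((𝒢.restrictFunctor₂ K' K hV hE).obj X))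
        (F.map (extCounitIso 𝒢 hV w hw ((𝒢.restrictFunctor₂ K' K hV hE).obj X)).inv x)) =
    σ.hom.app X x
  -- naturality of `σ` along the unit, whose `w`-component is the inverse of the counit
  have hu : (extUnit 𝒢 hV hE hcl X).fS ⟨w, hV hw⟩ =
      (extCounitIso 𝒢 hV w hw ((𝒢.restrictFunctor₂ K' K hV hE).obj X)).inv :=
    (Iso.comp_hom_eq_id _).mp (extUnit_fS_comp_extCounitIso_hom 𝒢 hV hE hcl w hw X)
  have h3 := hσnat (extUnit 𝒢 hV hE hcl X) x
  rw [hu] at h3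
  rw [h3]
  exact FintypeCat.inv_hom_id_apply
    (F.mapIso (extCounitIso 𝒢 hV w hw ((𝒢.restrictFunctor₂ K' K hV hE).obj X))) (σ.hom.app X x)

end SemiGraphOfAnabelioids

end Literature.AnabelianGeometry.SemiGraphs
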